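import Summits.Langlands.Langlands.Theses.ParityBlindBianchi
import Summits.Langlands.Langlands.Theorems.ParityBlindBianchiResidualBianchiDoorMod2TwoAdicModel
import Summits.Langlands.Langlands.Theorems.ParityBlindBianchiResidualBianchiDoorLevelQLevel
import Summits.Langlands.Langlands.Theorems.ParityBlindBianchiResidualBianchiDoorLevelCuspWitness
import Summits.Langlands.Langlands.Theorems.ParityBlindBianchiResidualBianchiDoorLevelBcTransfer
import HarnessLib

/-!
# `ParityBlindBianchi.ResidualBianchiDoorLevel` (E1′, crux stmt-Langlands-15112) from the named facts
# — line `Sketch` (card `serrekw-ctwist-strong-bc`), assembly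

The crux `Summit.Langlands.Langlands.Theses.ParityBlindBianchi.ResidualBianchiDoorLevel` PROVED MODULO
the four in-tree named facts `khare_wintenberger` (Khare–Wintenberger (I) Thm 1.2 + 9.1 with Kisin
2009; all `p`, `k`, only `p = 2` used), `baseChange_cyclic_cuspidal` (Arthur–Clozel Ch. 3 Thm 4.2 (a)),
`ArthurClozel1989_strongLifting_archimedean` and `ArthurClozel1989_strongLifting_allFinite`
(Arthur–Clozel Ch. 3 Thm 5.1, archimedean and all finite places): `ResidualBianchiDoorLevel_of_facts`.
`stub_qLevel` gives `S ∋ 2` (primes), the entrywise model `σ₀ = GL₂(ι⁻¹) ∘ ρ` and the regular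
algebraic cuspidal `π_ℚ` congruent to `σ₀` off `S`; for each imaginary quadratic 2-split `K` (neither
`IsTotallyComplex` nor the splitting of `2` is used) `exists_padicModel_restrictField` supplies the
same `σ₀` with `σ := σ₀|_{Γ_K}` entrywise `ι`-compatible with `ρ|_{Γ_K}`, of finite image,
irreducible, projectively `A₅`; `stub_cuspWitness` (an inert good place with `α ≠ -α`, Chebotarev)
and `stub_bcTransfer` (cuspidal base change + strong lifting) give the regular algebraic cuspidal `π₀`
on `GL₂(𝔸_K)` congruent to `σ` at EVERY place of `K` over no prime of `S`.  Trust base of the result: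
exactly the four named facts.
-/

noncomputable section

namespace Summit.Langlands.Langlands.Cruxes.ResidualBianchiDoorLevel.Sketch

set_option linter.dupNamespace false

-- (H5) `mixedSpace ℚ` needs classical `Fintype` instances on the place subtypes (as in `AdelicGLnGlue`).
open scoped MatrixGroups Polynomial Valued Classical
open Polynomial NumberField IsDedekindDomain Filter CongruenceSubgroup
open Literature.NumberTheory.Automorphic Literature.NumberTheory.GaloisRepresentations
  Literature.NumberTheory.EllipticCurves.ModularForms

/-- Two framed Galois representations with the same underlying group homomorphism are equal.
[folklore] -/
theorem framedGaloisRep_eq_of_toMonoidHom_eq {F : Type*} [Field F] {A : Type*} [CommRing A]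
    [TopologicalSpace A] {n : ℕ} {σ τ : FramedGaloisRep F A n}
    (h : σ.toMonoidHom = τ.toMonoidHom) : σ = τ :=
  ContinuousMonoidHom.ext fun g => by simpa using DFunLike.congr_fun h g

/-- **Composition (`ResidualBianchiDoorLevel` from the stubs)**: E1′ proved modulo the named facts
`khare_wintenberger` (all `p`, `k`), `baseChange_cyclic_cuspidal`,
`ArthurClozel1989_strongLifting_archimedean`, `ArthurClozel1989_strongLifting_allFinite`
taken as the four hypotheses (`proof.conditional`; trust base exactly these four names).
`stub_qLevel` gives `S ∋ 2` (primes), the entrywise model `σ₀ = GL₂(ι⁻¹) ∘ ρ` and the regular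
algebraic cuspidal `π_ℚ` congruent to `σ₀` off `S`; for each imaginary quadratic 2-split `K`
(`IsTotallyComplex` and the splitting of `2` are not used) the landed
`ResidualBianchiDoorMod2.exists_padicModel_restrictField` supplies the same `σ₀` (equal as framed
representations, `framedGaloisRep_eq_of_toMonoidHom_eq`) with `σ := σ₀|_{Γ_K}` entrywise `ι`-compatible
with `ρ|_{Γ_K}`, of finite image, irreducible, projectively `A₅`; `stub_cuspWitness` and
`stub_bcTransfer` give the regular algebraic cuspidal `π₀` on `GL₂(𝔸_K)` congruent to `σ` at every
place of `K` over no prime of `S`. -/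
theorem ResidualBianchiDoorLevel_of_facts
    (hKW : ∀ (p : ℕ) [Fact p.Prime] (k : Type) [Field k] [TopologicalSpace k] [DiscreteTopology k],
      khare_wintenberger p k)
    (hBC : baseChange_cyclic_cuspidal) (hArch : ArthurClozel1989_strongLifting_archimedean)
    (hR1 : ArthurClozel1989_strongLifting_allFinite) :
    Summit.Langlands.Langlands.Theses.ParityBlindBianchi.ResidualBianchiDoorLevel := by
  intro ι ρ hirr hA5
  obtain ⟨S, h2S, hS, σ₀, hσ₀, hcptQ, πQ, hRA, hgood⟩ := stub_qLevel hKW ι ρ hirr hA5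
  refine ⟨S, h2S, ?_⟩
  intro K _ _ _htc hdeg _hsplit
  -- the Galois side: the same `σ₀`, restricted to `Γ_K`
  obtain ⟨σ₀', hσ₀', hfin, hproj, hmodel, hfinK, hirrK, hA5K⟩ :=
    Summit.Langlands.Langlands.Theorems.ResidualBianchiDoorMod2.exists_padicModel_restrictField
      ι ρ hA5 K hdeg
  obtain rfl : σ₀' = σ₀ := framedGaloisRep_eq_of_toMonoidHom_eq (hσ₀'.trans hσ₀.symm)
  -- the automorphic side over `K`
  obtain ⟨hcpt, π₀, hRA₀, hgood₀⟩ := stub_bcTransfer hBC hArch hR1 ι σ₀' S hcptQ πQ hRA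
    hgood K hdeg (stub_cuspWitness ι σ₀' hfin hproj S hS hcptQ πQ hgood K hdeg)
  exact ⟨σ₀'.restrictField K, hmodel, hfinK, hirrK, hA5K, hcpt, π₀, hRA₀, hgood₀⟩


end Summit.Langlands.Langlands.Cruxes.ResidualBianchiDoorLevel.Sketch

end
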